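import Summits.BirchSwinnertonDyer.BirchSwinnertonDyer.Theses.SlopeDichotomyA2
import HarnessLib

/-!
# Route `SlopeDichotomyA2` (rung I1-weaken, corner A2): the Assembly item

The assembly item `stmt-BirchSwinnertonDyer-19088` of the ledger route
`route-BirchSwinnertonDyer-SlopeDichotomyA2` (cell `bsd-schneider-ideate`, D-0059 / D-0061 rung I1):
`DegenerateLocusA2 → PublishedInputsA2 → SchneiderWeaken.TypeBRankOneUnridered`.
It is exactly the route's kernel-checked deciding theorem `Theses.SlopeDichotomyA2.closes` (excluded
middle on the Schneider rider at the pair: the kernel's cyclotomic α-road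
`X1.bsdp_of_typeBRankOne_of_schneider` on the non-degenerate pairs, the crux on the degenerate ones).
Nothing else is asserted: the crux `DegenerateLocusA2` (item 19086, FRONTIER, verdict DECIDED-REDUCED
in the cell's record) and the support `PublishedInputsA2` (item 19087, five named published facts
after `mazur_tate_sigma_exists_odd_holds`) stay OPEN items; BSD is not advanced by this file.
[cite: GreenbergVatsal2000, Thm. (1.3)] [cite: BuyukbodukPollackSasaki2018, Thm. 1.1.6]
-/

-- the Theorems namespace of a single-conjunct summit repeats the summit name by design (D-0017)
set_option linter.dupNamespace false

namespace Summit.BirchSwinnertonDyer.BirchSwinnertonDyer.Theorems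

/-- **Assembly of route `SlopeDichotomyA2`** (item stmt-BirchSwinnertonDyer-19088): the crux
`DegenerateLocusA2` and the published-inputs conjunction `PublishedInputsA2` imply the rung-I1 leaf
`SchneiderWeaken.TypeBRankOneUnridered` (`BSD(E,p)` on every corner-A2 pair, Schneider rider
deleted) — by the route's own deciding theorem `Theses.SlopeDichotomyA2.closes` (cases on the rider).
Pure logic; closes the assembly node only. [cite: GreenbergVatsal2000, Thm. (1.3)] -/
theorem slopeDichotomyA2_assembly_proof :
    Summit.BirchSwinnertonDyer.BirchSwinnertonDyer.Theses.SlopeDichotomyA2.Assembly := by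
  intro h2 hF
  exact Theses.SlopeDichotomyA2.closes h2 hF

end Summit.BirchSwinnertonDyer.BirchSwinnertonDyer.Theorems
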